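import Mathlib
import Summits.Ventures.PercRepro2.Sep2OShieldSums
import Summits.Ventures.PercRepro2.HCovSwap

/-!
# THE UNIFIED o-SHIELD, mirrored: `K = {x, a₂}` separating `o` from `{b, a₁}`
(blind cell PercRepro2, night-1 g33; proofs/NIGHT1-G33.md §8″)

The root swap `a₁ ↔ a₂` (`btw_swap`, `A3Between_swap`, `PDEvent_swap`) carries Sep2OShieldSums to the
separator `{x, a₂}`: **`btw_sep2_o_mirror`**, `A3Between_sep2_o_mirror`, `HCov_sep2_o_mirror`.  Together
with `btw_sep2_o` (K = {x, a₁}), `CutOBehind.btw_cut_oBehind` (K = {x}) and `RootShield.btw_rootShield_o`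
(K = {a₁, a₂}) this is the o-SHIELD PRINCIPLE: for a separator K ⊆ {x, a₁, a₂} containing `x` or both
roots, if `o`'s side of `G − K` contains neither `b` nor a root outside `K`, then `btw(x) = 0`.
Standard axioms.
-/

namespace Summit.Ventures.PercRepro2

open UnionCluster CovForm CutV Sep2

namespace CovForm

namespace A3Fibre

namespace Sep2Shield

section Mirror

variable {V : Type*} {E : Type*} [Fintype V] [DecidableEq V] [Fintype E] [DecidableEq E]
  {R : Type*} [Field R] [LinearOrder R] [IsStrictOrderedRing R] {ends : E → Sym2 V} {x : V}
  {VA VB : Finset V} {EA EB : Set E} [DecidablePred (· ∈ EA)] [DecidablePred (· ∈ EB)] {p : E → R}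
  {a₁ a₂ o b : V}

/-- **The unified o-shield, mirrored**: `btw(x) = 0` when `{x, a₂}` separates `o` from `{b, a₁}` and
`P(PD_x) ≠ 0`. -/
theorem btw_sep2_o_mirror (hp : IsProbVec p) (h : IsSep2 ends x a₂ ↑VA ↑VB EA EB) (ho : o ∈ VA)
    (h1 : a₁ ∈ VB) (hb : b ∈ VB) (hD : prob p (PDEvent ends a₁ a₂ x) ≠ 0) :
    btw p ends o a₁ a₂ x b = 0 := by
  rw [← btw_swap]
  rw [← PDEvent_swap] at hD
  exact btw_sep2_o hp h ho h1 hb hD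

/-- (MEANS-a₃) at `x` in the mirrored unified o-shield class, unconditionally. -/
theorem A3Between_sep2_o_mirror (hp : IsProbVec p) (h : IsSep2 ends x a₂ ↑VA ↑VB EA EB)
    (ho : o ∈ VA) (h1 : a₁ ∈ VB) (hb : b ∈ VB) : A3Between p ends o a₁ a₂ x b :=
  (A3Between_swap p ends o a₁ a₂ x b).1 (A3Between_sep2_o hp h ho h1 hb)

/-- (HCOV) at `x` in the mirrored unified o-shield class. -/
theorem HCov_sep2_o_mirror (hp : IsProbVec p) (h : IsSep2 ends x a₂ ↑VA ↑VB EA EB) (ho : o ∈ VA)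
    (h1 : a₁ ∈ VB) (hb : b ∈ VB) : HCov p ends o a₁ a₂ x b :=
  HCov_of_a3Between hp ends o a₁ a₂ x b (A3Between_sep2_o_mirror hp h ho h1 hb)

end Mirror

end Sep2Shield

end A3Fibre

end CovForm

end Summit.Ventures.PercRepro2
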